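import Summits.AtomisticToContinuum.HydrodynamicLimit.Theses.TwoClocks
import Summits.AtomisticToContinuum.HydrodynamicLimit.Theorems.TwoClocksTransferEntropyClockCoherence
import Summits.AtomisticToContinuum.HydrodynamicLimit.Theorems.OneFlightGossipEngineClampedCurrentsDockCubicChannelPrelim
import HarnessLib

/-!
# The coherence input from a tagged-particle window LLN for bounded odd peculiar-velocity functionals plus the cubic
# energy tails (support file, line `Sketch`, crux stmt-AtomisticToContinuum-16625 `TwoClocks.TransferEntropyClock`, lead c5)

Crux `TwoClocks.TransferEntropyClock` (stmt-AtomisticToContinuum-16625), line `Sketch`. The registered stub S5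
`stub_coherence : HydroLimitInBandOfHeart.CoherentSuprathermalContentVanishesW` (CSCV-W, the heart's weighted
suprathermal-coherence input, a true-law statement) is RESHAPED by this file into the cleaner node `BoundedOddWindowLLN` (§1):
the window law of large numbers, in `L¹` and particle average, for BOUNDED ODD radial functionals `R(s, x_i, ‖W_i‖²) W_i` of
the peculiar velocity `W_i = v_i − u_s(x_i)` relative to the Euler field, under the true pre-shock law — linear in the tested
functional, no cubic weights, no coherence fraction `η`, no suprathermal level `K⋆`.

Main result (§3): **`coherence_of_boundedOddWindowLLN : BoundedOddWindowLLN → TwoClocks.EnergyCurrentTails → CSCV-W`**, registered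
as stub S5g `stub_coherenceOfOddWindowLLN : CoherenceOfOddWindowLLN` of skeleton v8 (the open stub S5′ is `stub_oddWindowLLN : BoundedOddWindowLLN`).
Proof: pathwise on the good set, `1{η·cub < ‖q̄‖} cubHi ≤ ‖q̄‖/η` (because `cubHi ≤ cub`, landed
`TransferEntropyClockCoherence.windowAvg_hi_le_cub`); split the weight at a level `V`, `R = R 1{s′ ≤ V²} + R 1{s′ > V²}`: the low part
is a bounded odd functional, whose window average is small in `L¹` by the node; the high part is dominated pathwise by the window
integral of the absolute cubic velocity tail `8·1{M < ‖v_i‖}‖v_i‖³` once `V ≥ M + U`, `V > 2U` (`U = sup ‖u‖` on the slab,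
`ClampedCurrentsDockCubicChannelPrelim.slab_package`), and its expectation is small by the fixed-time cubic tails
`EnergyCurrentTails` integrated over the window (Tonelli on the good set, landed `ClampedCurrentsDockCubicChannelPrelim.cubicTailWindow`).
So the crux's fourth antecedent ECT now also prices the suprathermal part of the coherence input, and the open content of S5 is
the bounded odd window LLN alone (conjecture-grade, like CSCV-W: physically it says that the true local mean velocity is the Euler
velocity in window-`L¹` sense and that a tagged particle's velocity direction decorrelates over `τσ²` mean free times as
`τ → ∞`; neither is derivable from the crux's antecedents).
-/

noncomputable section

open MeasureTheory Filter Set Topology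
open scoped ENNReal

namespace Summit.AtomisticToContinuum.HydrodynamicLimit.Theorems.TransferEntropyClockOddWindowLLN

open Literature.MathematicalPhysics.KineticTheory Literature.Analysis.FluidPDE Literature.Analysis.FunctionSpaces
open Summit.AtomisticToContinuum.HydrodynamicLimit.Theses
open Summit.AtomisticToContinuum.HydrodynamicLimit.Theorems.HydroLimitInBandOfHeart (CoherentSuprathermalContentVanishesW)
open Summit.AtomisticToContinuum.HydrodynamicLimit.Theorems.TransferEntropyClockCoherence
open Summit.AtomisticToContinuum.HydrodynamicLimit.Theorems.ClampedCurrentsDockCubicChannelPrelim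
  (measurable_tailSum cubicTailWindow slab_package tendsto_window_zero)

/-! ## §1 The node: window LLN for bounded odd functionals of the peculiar velocity under the true law -/

/-- **Tagged-particle window law of large numbers for bounded odd functionals of the peculiar velocity, under the TRUE
pre-shock law (`BoundedOddWindowLLN`).** Frame of `EnergyCurrentTails` / `CoherentSuprathermalContentVanishesW` (local Gibbs
data tied to a classical hard-sphere Euler solution by the `t = 0` LLN, every family of hard-sphere flows, every `t < T`). For
every level `V` and every measurable radial weight `R(s, x, s′)` with `R = 0` for `s′ > V²` and `|R(s, x, s′)| ≤ |s′|` — so that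
the tested one-particle functional `R(s, x_i, ‖W_i‖²) W_i`, `W_i(r) = v_i(r) − u_s(x_i(r))`, is ODD in the peculiar velocity and
bounded by `|V|³` — the particle average of the norm of its time average over the kinetic window `[s, s + τ(N+1)^{-1/3}]`
vanishes in `L¹(localGibbsLaw)`: `∀ ε ∃ τ₀ ∀ τ ≥ τ₀ ∃ N₀ ∀ N ≥ N₀ ∀ s ∈ [0, t]`,
`E[(N+1)⁻¹ Σ_i ‖w⁻¹ ∫_s^{s+w} R(s, x_i, ‖W_i‖²) W_i dr‖] ≤ ε`. Physically: the true local mean velocity is the Euler velocity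
(window-`L¹`) and the direction of a tagged particle's peculiar velocity decorrelates over `τσ²` mean free times. Conjecture-grade
(true-law input, same status as CSCV-W, which it implies given `EnergyCurrentTails`: `coherence_of_boundedOddWindowLLN`). -/
def BoundedOddWindowLLN : Prop :=
  ∀ (a₀ θ₀ : T3 → ℝ) (u₀ : T3 → V3), Continuous a₀ → Continuous θ₀ → Continuous u₀ →
    (∀ x, 0 < a₀ x) → (∀ x, 0 < θ₀ x) →
    ∃ σ₀ : ℝ, 0 < σ₀ ∧ ∀ σ : ℝ, 0 < σ → σ < σ₀ →
    ∀ (T : ℝ) (ρ θ : ℝ → T3 → ℝ) (u : ℝ → T3 → V3), IsHardSphereEulerSolution σ T ρ u θ →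
    ∀ Φ : (N : ℕ) → HardSphereFlow (Torus.geometry (Fin 3)) (hsDiameter σ N) (N + 1),
    TendstoHydroFieldsAt (fun N => localGibbsLaw σ a₀ u₀ θ₀ N (Φ N)) Φ ρ u θ 0 →
    ∀ t ∈ Set.Ico 0 T, ∀ V : ℝ,
    ∀ R : ℝ → T3 → ℝ → ℝ, Measurable (fun p : ℝ × T3 × ℝ => R p.1 p.2.1 p.2.2) →
    (∀ s x s', V ^ 2 < s' → R s x s' = 0) → (∀ s x s', |R s x s'| ≤ |s'|) →
    ∀ ε : ℝ, 0 < ε →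
    ∃ τ₀ : ℝ, 0 < τ₀ ∧ ∀ τ : ℝ, τ₀ ≤ τ → ∃ N₀ : ℕ, ∀ N : ℕ, N₀ ≤ N → ∀ s ∈ Set.Icc 0 t,
      (let w : ℝ := τ * ((N : ℝ) + 1) ^ (-(1 / 3 : ℝ))
       let P := localGibbsLaw σ a₀ u₀ θ₀ N (Φ N)
       let W := fun (i : Fin (N + 1)) (s r : ℝ) (z : Config (N + 1) (Fin 3) T3) =>
         ((Φ N).flow r z i).2 - u s ((Φ N).flow r z i).1
       let qbar := fun (i : Fin (N + 1)) (s : ℝ) (z : Config (N + 1) (Fin 3) T3) =>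
         w⁻¹ • ∫ r in s..(s + w), (R s ((Φ N).flow r z i).1 (‖W i s r z‖ ^ 2)) • W i s r z
       ∫⁻ z, ENNReal.ofReal (((N : ℝ) + 1)⁻¹ * ∑ i : Fin (N + 1), ‖qbar i s z‖) ∂P ≤ ENNReal.ofReal ε)

/-- **S5g, the registered glue stub of skeleton v8 (line `Sketch`)**: the coherence input from the bounded odd window LLN and the
cubic energy tails `TwoClocks.EnergyCurrentTails` (the crux's 4th antecedent). Proved below (`stub_coherenceOfOddWindowLLN`). -/
def CoherenceOfOddWindowLLN : Prop :=
  BoundedOddWindowLLN → TwoClocks.EnergyCurrentTails → CoherentSuprathermalContentVanishesW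

/-! ## §2 Pathwise inequalities -/

/-- Elementary: for `0 < η`, `h ≤ c` and `0 ≤ q`, `1{η c < q} h ≤ q / η`. [folklore] -/
theorem ite_le_div {η c h q : ℝ} (hη : 0 < η) (hhc : h ≤ c) (hq : 0 ≤ q) :
    (if η * c < q then h else 0) ≤ q / η := by
  split_ifs with hlt
  · rw [le_div_iff₀ hη]
    calc h * η ≤ c * η := mul_le_mul_of_nonneg_right hhc hη.le
      _ = η * c := mul_comm _ _
      _ ≤ q := hlt.le
  · exact div_nonneg hq hη.le

/-- A weighted signal `ρ(r, ‖W r‖²) • W r` with `|ρ(r, s′)| ≤ |s′|`, `W` measurable with integrable cube on the window and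
`r ↦ ρ(r, ‖W r‖²)` measurable, is interval integrable. [folklore] -/
theorem intervalIntegrable_weight_smul {s w : ℝ} {ρ : ℝ → ℝ → ℝ} (hρ : ∀ r s', |ρ r s'| ≤ |s'|) {W : ℝ → V3}
    (hWm : Measurable W) (hρm : Measurable fun r => ρ r (‖W r‖ ^ 2))
    (hint : IntervalIntegrable (fun r => ‖W r‖ ^ 3) volume s (s + w)) :
    IntervalIntegrable (fun r => ρ r (‖W r‖ ^ 2) • W r) volume s (s + w) := by
  refine hint.mono_fun' (hρm.smul hWm).aestronglyMeasurable (Eventually.of_forall fun r => ?_)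
  dsimp only
  rw [norm_smul, Real.norm_eq_abs]
  calc |ρ r (‖W r‖ ^ 2)| * ‖W r‖ ≤ |‖W r‖ ^ 2| * ‖W r‖ := mul_le_mul_of_nonneg_right (hρ _ _) (norm_nonneg _)
    _ = ‖W r‖ ^ 3 := by rw [abs_of_nonneg (sq_nonneg _)]; ring

/-- **Splitting the weight at level `V`.** For `w > 0`, a weight `ρ` with `|ρ(r, s′)| ≤ |s′|` and a measurable signal `W` with
integrable cube: `‖w⁻¹ • ∫ ρ(‖W‖²) • W‖ ≤ ‖w⁻¹ • ∫ (ρ 1{‖W‖² ≤ V²})(‖W‖²) • W‖ + w⁻¹ ∫ 1{V < ‖W‖} ‖W‖³`. [folklore] -/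
theorem norm_windowAvg_le_split {V s w : ℝ} (hw : 0 < w) {ρ : ℝ → ℝ → ℝ} (hρ : ∀ r s', |ρ r s'| ≤ |s'|)
    {W : ℝ → V3} (hWm : Measurable W) (hρm : Measurable fun r => ρ r (‖W r‖ ^ 2))
    (hint : IntervalIntegrable (fun r => ‖W r‖ ^ 3) volume s (s + w)) :
    ‖w⁻¹ • ∫ r in s..(s + w), ρ r (‖W r‖ ^ 2) • W r‖ ≤
      ‖w⁻¹ • ∫ r in s..(s + w), (if ‖W r‖ ^ 2 ≤ V ^ 2 then ρ r (‖W r‖ ^ 2) else 0) • W r‖ +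
        w⁻¹ * ∫ r in s..(s + w), (if V < ‖W r‖ then ‖W r‖ ^ 3 else (0 : ℝ)) := by
  -- the two pieces of the weight
  set ρlo : ℝ → ℝ → ℝ := fun r s' => if s' ≤ V ^ 2 then ρ r s' else 0 with hρlo
  set ρhi : ℝ → ℝ → ℝ := fun r s' => if s' ≤ V ^ 2 then 0 else ρ r s' with hρhi
  have hlo : ∀ r s', |ρlo r s'| ≤ |s'| := fun r s' => by
    simp only [hρlo]; split_ifs; exacts [hρ r s', by simp]
  have hhi : ∀ r s', |ρhi r s'| ≤ |s'| := fun r s' => by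
    simp only [hρhi]; split_ifs; exacts [by simp, hρ r s']
  have hhi0 : ∀ r s', s' ≤ V ^ 2 → ρhi r s' = 0 := fun r s' h => by simp only [hρhi, if_pos h]
  have hmS : MeasurableSet {r | ‖W r‖ ^ 2 ≤ V ^ 2} := measurableSet_le (hWm.norm.pow_const 2) measurable_const
  have hlom : Measurable fun r => ρlo r (‖W r‖ ^ 2) := Measurable.ite hmS hρm measurable_const
  have hhim : Measurable fun r => ρhi r (‖W r‖ ^ 2) := Measurable.ite hmS measurable_const hρm
  have hsplit : ∀ r, ρ r (‖W r‖ ^ 2) • W r = ρlo r (‖W r‖ ^ 2) • W r + ρhi r (‖W r‖ ^ 2) • W r := fun r => by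
    rw [← add_smul]
    congr 1
    simp only [hρlo, hρhi]
    split_ifs <;> simp
  have hIlo := intervalIntegrable_weight_smul hlo hWm hlom hint
  have hIhi := intervalIntegrable_weight_smul hhi hWm hhim hint
  have heq : ∫ r in s..(s + w), ρ r (‖W r‖ ^ 2) • W r =
      (∫ r in s..(s + w), ρlo r (‖W r‖ ^ 2) • W r) + ∫ r in s..(s + w), ρhi r (‖W r‖ ^ 2) • W r := by
    rw [← intervalIntegral.integral_add hIlo hIhi]
    exact intervalIntegral.integral_congr fun r _ => hsplit r
  rw [heq, smul_add]
  refine (norm_add_le _ _).trans (add_le_add le_rfl ?_)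
  exact norm_windowAvg_weight_smul_le hw hhi0 hhi W (intervalIntegrable_hi hWm hint)

/-- **The suprathermal peculiar cube is dominated by the absolute cubic tail**: if `‖u(x)‖ ≤ U`, `M + U ≤ V` and `2U < V`, then
`1{V < ‖v − u(x)‖} ‖v − u(x)‖³ ≤ 8 · 1{M < ‖v‖} ‖v‖³`. [folklore] -/
theorem hiCube_le_indicator {V U M : ℝ} {uu : T3 → V3} {x : T3} (hU : ‖uu x‖ ≤ U) (hM : M + U ≤ V)
    (hU2 : 2 * U < V) (v : V3) :
    (if V < ‖v - uu x‖ then ‖v - uu x‖ ^ 3 else (0 : ℝ)) ≤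
      8 * Set.indicator {v : V3 | M < ‖v‖} (fun v => ‖v‖ ^ 3) v := by
  split_ifs with hV
  · have h1 : ‖v - uu x‖ ≤ ‖v‖ + U := (norm_sub_le _ _).trans (add_le_add le_rfl hU)
    have h2 : M < ‖v‖ := by linarith
    have h3 : ‖v - uu x‖ ≤ 2 * ‖v‖ := by linarith
    rw [Set.indicator_of_mem (show v ∈ {v : V3 | M < ‖v‖} from h2)]
    calc ‖v - uu x‖ ^ 3 ≤ (2 * ‖v‖) ^ 3 := pow_le_pow_left₀ (norm_nonneg _) h3 3
      _ = 8 * ‖v‖ ^ 3 := by ring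
  · exact mul_nonneg (by norm_num) (Set.indicator_nonneg (fun v _ => by positivity) _)

variable {ε : ℝ} {n : ℕ}

/-- Along a good orbit the absolute cubic tail of one particle is interval integrable (bounded by the conserved energy,
measurable in time). [folklore] -/
theorem intervalIntegrable_indicator_vel (Φ : HardSphereFlow (Torus.geometry (Fin 3)) ε n) {z : Config n (Fin 3) T3}
    (hz : z ∈ Φ.good) (M : ℝ) (i : Fin n) (a b : ℝ) :
    IntervalIntegrable (fun r => Set.indicator {v : V3 | M < ‖v‖} (fun v => ‖v‖ ^ 3) (Φ.flow r z i).2) volume a b := by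
  have hm : Measurable fun r => Set.indicator {v : V3 | M < ‖v‖} (fun v => ‖v‖ ^ 3) (Φ.flow r z i).2 :=
    ((measurable_norm.pow_const 3).indicator (measurableSet_lt measurable_const measurable_norm)).comp
      (Φ.measurable_vel_orbit hz i)
  refine (intervalIntegrable_const (c := Real.sqrt (2 * configEnergy z) ^ 3)).mono_fun' hm.aestronglyMeasurable
    (ae_of_all _ fun r => ?_)
  dsimp only
  rw [Real.norm_eq_abs, abs_of_nonneg (Set.indicator_nonneg (fun v _ => by positivity) _)]
  refine (Set.indicator_le_self' (fun v _ => by positivity) _).trans ?_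
  exact pow_le_pow_left₀ (norm_nonneg _) (Φ.norm_vel_flow_le hz r i) 3

/-- **The coherence summand of one particle along a good orbit** is at most `η⁻¹ ×` (the norm of the window average of the
LOW part of the weight) `+ 8 η⁻¹ w⁻¹ ×` (the window integral of the absolute cubic tail at level `M`), provided
`‖u_s‖ ≤ U`, `M + U ≤ V`, `2U < V`. [folklore] -/
theorem coherenceSummand_orbit_le (Φ : HardSphereFlow (Torus.geometry (Fin 3)) ε n) {z : Config n (Fin 3) T3}
    (hz : z ∈ Φ.good) {uu : T3 → V3} (hu : Continuous uu) {U : ℝ} (hU : ∀ x, ‖uu x‖ ≤ U)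
    {Rw : T3 → ℝ → ℝ} (hRm : Measurable fun p : T3 × ℝ => Rw p.1 p.2) (hR : ∀ x s', |Rw x s'| ≤ |s'|)
    {K V M s w η : ℝ} (hw : 0 < w) (hη : 0 < η) (hM : M + U ≤ V) (hU2 : 2 * U < V) (i : Fin n) :
    (if η * (w⁻¹ * ∫ r in s..(s + w), ‖(Φ.flow r z i).2 - uu (Φ.flow r z i).1‖ ^ 3) <
          ‖w⁻¹ • ∫ r in s..(s + w), Rw (Φ.flow r z i).1 (‖(Φ.flow r z i).2 - uu (Φ.flow r z i).1‖ ^ 2) •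
            ((Φ.flow r z i).2 - uu (Φ.flow r z i).1)‖ then
        w⁻¹ * ∫ r in s..(s + w), (if K < ‖(Φ.flow r z i).2 - uu (Φ.flow r z i).1‖ then
          ‖(Φ.flow r z i).2 - uu (Φ.flow r z i).1‖ ^ 3 else (0 : ℝ)) else 0) ≤
      η⁻¹ * ‖w⁻¹ • ∫ r in s..(s + w),
          (if ‖(Φ.flow r z i).2 - uu (Φ.flow r z i).1‖ ^ 2 ≤ V ^ 2 then
            Rw (Φ.flow r z i).1 (‖(Φ.flow r z i).2 - uu (Φ.flow r z i).1‖ ^ 2) else 0) •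
            ((Φ.flow r z i).2 - uu (Φ.flow r z i).1)‖ +
        8 * η⁻¹ * w⁻¹ * ∫ r in s..(s + w), Set.indicator {v : V3 | M < ‖v‖} (fun v => ‖v‖ ^ 3) (Φ.flow r z i).2 := by
  set W : ℝ → V3 := fun r => (Φ.flow r z i).2 - uu (Φ.flow r z i).1 with hW
  have hWm : Measurable W := measurable_peculiar_orbit Φ hz hu i
  have hxc : Continuous fun r => (Φ.flow r z i).1 := (Φ.isTrajectory z hz).pos_continuous i
  have hint3 : IntervalIntegrable (fun r => ‖W r‖ ^ 3) volume s (s + w) :=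
    intervalIntegrable_norm_peculiar_pow Φ hz hu i 3 s (s + w)
  have hρm : Measurable fun r => Rw (Φ.flow r z i).1 (‖W r‖ ^ 2) :=
    hRm.comp (hxc.measurable.prodMk (hWm.norm.pow_const 2))
  -- Step 1: the summand is at most `‖q̄‖ / η`
  have h1 := ite_le_div hη (windowAvg_hi_le_cub (K := K) hw W hint3)
    (norm_nonneg (w⁻¹ • ∫ r in s..(s + w), Rw (Φ.flow r z i).1 (‖W r‖ ^ 2) • W r))
  -- Step 2: split the weight at level `V`
  have h2 := norm_windowAvg_le_split (V := V) hw (ρ := fun r s' => Rw (Φ.flow r z i).1 s') (fun r s' => hR _ s') hWm hρm hint3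
  -- Step 3: the suprathermal tail against the absolute cubic tail
  have hsw : s ≤ s + w := by linarith
  have h3 : ∫ r in s..(s + w), (if V < ‖W r‖ then ‖W r‖ ^ 3 else (0 : ℝ)) ≤
      8 * ∫ r in s..(s + w), Set.indicator {v : V3 | M < ‖v‖} (fun v => ‖v‖ ^ 3) (Φ.flow r z i).2 := by
    rw [← intervalIntegral.integral_const_mul]
    refine intervalIntegral.integral_mono_on hsw (intervalIntegrable_hi hWm hint3)
      ((intervalIntegrable_indicator_vel Φ hz M i s (s + w)).const_mul 8) fun r _ => ?_
    exact hiCube_le_indicator (hU _) hM hU2 _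
  -- combine
  have hη' : 0 ≤ η⁻¹ := inv_nonneg.2 hη.le
  have hw' : 0 ≤ w⁻¹ := inv_nonneg.2 hw.le
  calc _ ≤ _ := h1
    _ ≤ (‖w⁻¹ • ∫ r in s..(s + w), (if ‖W r‖ ^ 2 ≤ V ^ 2 then Rw (Φ.flow r z i).1 (‖W r‖ ^ 2) else 0) • W r‖ +
          w⁻¹ * (8 * ∫ r in s..(s + w), Set.indicator {v : V3 | M < ‖v‖} (fun v => ‖v‖ ^ 3) (Φ.flow r z i).2)) / η := by
        refine div_le_div_of_nonneg_right (h2.trans (add_le_add le_rfl ?_)) hη.le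
        exact mul_le_mul_of_nonneg_left h3 hw'
    _ = _ := by rw [div_eq_inv_mul]; ring

/-! ## §3 The glue: `BoundedOddWindowLLN → EnergyCurrentTails → CoherentSuprathermalContentVanishesW` -/

/-- **The coherence input from the bounded odd window LLN and the cubic energy tails.** With `K⋆ := 1` and, given
`(η, ε)`: the level `M` of `EnergyCurrentTails` at accuracy `ηε/32` on the slab `[0, (t+T)/2]`, `U := sup ‖u‖` there,
`V := 2U + max M 0 + 1`; the node applied to the truncated weight `R 1{s′ ≤ V²}` at accuracy `ηε/2`; windows short enough that
`s + w ≤ (t+T)/2`. Pathwise `coherenceSummand_orbit_le` on the good set (which carries `localGibbsLaw`), then the two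
expectations: the node, and `cubicTailWindow` (Tonelli) fed by the fixed-time tails. [folklore] -/
theorem coherence_of_boundedOddWindowLLN (hL : BoundedOddWindowLLN) (hT : TwoClocks.EnergyCurrentTails) :
    CoherentSuprathermalContentVanishesW := by
  intro a₀ θ₀ u₀ ha hθ hu ha0 hθ0
  obtain ⟨σ₁, hσ₁, H1⟩ := hL a₀ θ₀ u₀ ha hθ hu ha0 hθ0
  obtain ⟨σ₂, hσ₂, H2⟩ := hT a₀ θ₀ u₀ ha hθ hu ha0 hθ0
  refine ⟨min (min σ₁ σ₂) (1 / 2), lt_min (lt_min hσ₁ hσ₂) (by norm_num), ?_⟩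
  intro σ hσ hσlt T ρ θ u hE Φ htie t ht
  have hσ1 : σ < σ₁ := hσlt.trans_le ((min_le_left _ _).trans (min_le_left _ _))
  have hσ2 : σ < σ₂ := hσlt.trans_le ((min_le_left _ _).trans (min_le_right _ _))
  have hσh : σ < 1 / 2 := hσlt.trans_le (min_le_right _ _)
  refine ⟨1, one_pos, ?_⟩
  intro R hRm _hR0 hR η hη ε hε
  -- the slab `[0, t']`, `t' = (t + T)/2`
  set t' : ℝ := (t + T) / 2 with ht'def
  have htt' : t < t' := by rw [ht'def]; linarith [ht.2]
  have ht' : t' ∈ Set.Ico 0 T := ⟨by rw [ht'def]; linarith [ht.1, ht.2], by rw [ht'def]; linarith [ht.2]⟩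
  -- the cubic energy tails at accuracy `e`
  set e : ℝ := η * ε / 32 with hedef
  have he : 0 < e := by positivity
  obtain ⟨M, N₁, HM⟩ := H2 σ hσ hσ2 T ρ θ u hE Φ htie t' ht' e he
  -- the velocity bound on the slab `[0, t]`
  obtain ⟨θM, U, Bb, Lb, -, hU0, -, -, hslab⟩ := slab_package hE ht
  set V : ℝ := 2 * U + max M 0 + 1 with hVdef
  have hMV : M + U ≤ V := by rw [hVdef]; linarith [le_max_left M 0, le_max_right M 0]
  have hU2 : 2 * U < V := by rw [hVdef]; linarith [le_max_right M 0]
  -- the truncated weight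
  have hRlo_m : Measurable (fun p : ℝ × T3 × ℝ => if p.2.2 ≤ V ^ 2 then R p.1 p.2.1 p.2.2 else 0) :=
    Measurable.ite (measurableSet_le measurable_snd.snd measurable_const) hRm measurable_const
  have hRlo_supp : ∀ s x s', V ^ 2 < s' → (if s' ≤ V ^ 2 then R s x s' else 0) = 0 := fun s x s' h =>
    if_neg (not_le.2 h)
  have hRlo_le : ∀ s x s', |(if s' ≤ V ^ 2 then R s x s' else 0)| ≤ |s'| := fun s x s' => by
    split_ifs; exacts [hR s x s', by simp]
  obtain ⟨τ₀, hτ₀, Hτ⟩ := H1 σ hσ hσ1 T ρ θ u hE Φ htie t ht V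
    (fun s x s' => if s' ≤ V ^ 2 then R s x s' else 0) hRlo_m hRlo_supp hRlo_le (η * ε / 2) (by positivity)
  refine ⟨τ₀, hτ₀, fun τ hτ => ?_⟩
  obtain ⟨N₂, HN₂⟩ := Hτ τ hτ
  -- windows short enough to stay in the slab `[0, t']`
  obtain ⟨N₃, HN₃⟩ : ∃ N₃ : ℕ, ∀ N : ℕ, N₃ ≤ N → τ * ((N : ℝ) + 1) ^ (-(1 / 3 : ℝ)) < t' - t := by
    have h := (tendsto_order.1 (tendsto_window_zero τ)).2 (t' - t) (by linarith)
    exact eventually_atTop.1 h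
  refine ⟨max N₁ (max N₂ N₃), fun N hN s hs => ?_⟩
  have hN₁ : N₁ ≤ N := (le_max_left _ _).trans hN
  have hN₂ : N₂ ≤ N := ((le_max_left _ _).trans (le_max_right _ _)).trans hN
  have hN₃ : N₃ ≤ N := ((le_max_right _ _).trans (le_max_right _ _)).trans hN
  have HLs := HN₂ N hN₂ s hs
  dsimp only at HLs ⊢
  -- notation
  set w : ℝ := τ * ((N : ℝ) + 1) ^ (-(1 / 3 : ℝ)) with hwdef
  have hw : 0 < w := mul_pos (hτ₀.trans_le hτ) (Real.rpow_pos_of_pos (by positivity) _)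
  have hNpos : (0 : ℝ) < (N : ℝ) + 1 := by positivity
  set P := localGibbsLaw σ a₀ u₀ θ₀ N (Φ N) with hPdef
  have hus : Continuous (u s) := (hslab s hs).2.1
  have hUs : ∀ x, ‖u s x‖ ≤ U := (hslab s hs).2.2.2.2.2.1
  have hRs : Measurable fun p : T3 × ℝ => R s p.1 p.2 := hRm.comp (measurable_const.prodMk measurable_id)
  -- the window tail bound from the fixed-time tails (Tonelli)
  have hsw' : s + w ≤ t' := by have := HN₃ N hN₃; rw [← hwdef] at this; linarith [hs.2]
  have htailW : ∫⁻ z, ENNReal.ofReal (∫ r in s..(s + w), ∑ i : Fin (N + 1),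
      Set.indicator {v : V3 | M < ‖v‖} (fun v => ‖v‖ ^ 3) (((Φ N).flow r z i).2)) ∂P ≤
      ENNReal.ofReal (w * ((N : ℝ) + 1) * e) :=
    cubicTailWindow σ N (Φ N) a₀ θ₀ u₀ M e s w hσ hσh ha hθ hu ha0 hθ0 he.le hw.le fun r hr =>
      HM N hN₁ r ⟨hs.1.trans hr.1, hr.2.trans hsw'⟩
  -- a.e.-measurability of the window tail functional (joint measurability of the flow on the good set)
  have hPgood : P (Φ N).goodᶜ = 0 := localGibbsLaw_absolutelyContinuous σ a₀ u₀ θ₀ N (Φ N) (Φ N).measure_compl_good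
  set C : ℝ := 8 * η⁻¹ * w⁻¹ * ((N : ℝ) + 1)⁻¹ with hCdef
  have hC0 : 0 ≤ C := by positivity
  have hg : AEMeasurable (fun z => ENNReal.ofReal (C * ∫ r in s..(s + w), ∑ i : Fin (N + 1),
      Set.indicator {v : V3 | M < ‖v‖} (fun v => ‖v‖ ^ 3) (((Φ N).flow r z i).2))) P :=
    (((Φ N).aemeasurable_intervalIntegral_comp_flow_torus (measurable_tailSum N M) s (s + w) hPgood).const_mul
      C).ennreal_ofReal
  -- the pointwise bound on the good set
  have hpt : ∀ z ∈ (Φ N).good,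
      ((N : ℝ) + 1)⁻¹ * ∑ i : Fin (N + 1),
        (if η * (w⁻¹ * ∫ r in s..(s + w), ‖((Φ N).flow r z i).2 - u s ((Φ N).flow r z i).1‖ ^ 3) <
            ‖w⁻¹ • ∫ r in s..(s + w), R s ((Φ N).flow r z i).1 (‖((Φ N).flow r z i).2 - u s ((Φ N).flow r z i).1‖ ^ 2) •
              (((Φ N).flow r z i).2 - u s ((Φ N).flow r z i).1)‖ then
          w⁻¹ * ∫ r in s..(s + w), (if (1 : ℝ) < ‖((Φ N).flow r z i).2 - u s ((Φ N).flow r z i).1‖ then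
            ‖((Φ N).flow r z i).2 - u s ((Φ N).flow r z i).1‖ ^ 3 else (0 : ℝ)) else 0) ≤
      η⁻¹ * (((N : ℝ) + 1)⁻¹ * ∑ i : Fin (N + 1), ‖w⁻¹ • ∫ r in s..(s + w),
          (if ‖((Φ N).flow r z i).2 - u s ((Φ N).flow r z i).1‖ ^ 2 ≤ V ^ 2 then
            R s ((Φ N).flow r z i).1 (‖((Φ N).flow r z i).2 - u s ((Φ N).flow r z i).1‖ ^ 2) else 0) •
            (((Φ N).flow r z i).2 - u s ((Φ N).flow r z i).1)‖) +
        C * ∫ r in s..(s + w), ∑ i : Fin (N + 1),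
          Set.indicator {v : V3 | M < ‖v‖} (fun v => ‖v‖ ^ 3) (((Φ N).flow r z i).2) := by
    intro z hz
    have hsum := Finset.sum_le_sum fun i (_ : i ∈ Finset.univ) =>
      coherenceSummand_orbit_le (Φ N) hz hus hUs hRs (fun x s' => hR s x s') (K := 1) (s := s) hw hη hMV hU2 i
    rw [Finset.sum_add_distrib, ← Finset.mul_sum, ← Finset.mul_sum,
      ← intervalIntegral.integral_finsetSum fun i _ => intervalIntegrable_indicator_vel (Φ N) hz M i s (s + w)] at hsum
    calc _ ≤ ((N : ℝ) + 1)⁻¹ * (η⁻¹ * ∑ i : Fin (N + 1), ‖w⁻¹ • ∫ r in s..(s + w),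
          (if ‖((Φ N).flow r z i).2 - u s ((Φ N).flow r z i).1‖ ^ 2 ≤ V ^ 2 then
            R s ((Φ N).flow r z i).1 (‖((Φ N).flow r z i).2 - u s ((Φ N).flow r z i).1‖ ^ 2) else 0) •
            (((Φ N).flow r z i).2 - u s ((Φ N).flow r z i).1)‖ +
          8 * η⁻¹ * w⁻¹ * ∫ r in s..(s + w), ∑ i : Fin (N + 1),
            Set.indicator {v : V3 | M < ‖v‖} (fun v => ‖v‖ ^ 3) (((Φ N).flow r z i).2)) :=
          mul_le_mul_of_nonneg_left hsum (inv_nonneg.2 hNpos.le)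
      _ = _ := by rw [hCdef]; ring
  -- integrate
  calc _ ≤ ∫⁻ z, (ENNReal.ofReal (η⁻¹ * (((N : ℝ) + 1)⁻¹ * ∑ i : Fin (N + 1), ‖w⁻¹ • ∫ r in s..(s + w),
          (if ‖((Φ N).flow r z i).2 - u s ((Φ N).flow r z i).1‖ ^ 2 ≤ V ^ 2 then
            R s ((Φ N).flow r z i).1 (‖((Φ N).flow r z i).2 - u s ((Φ N).flow r z i).1‖ ^ 2) else 0) •
            (((Φ N).flow r z i).2 - u s ((Φ N).flow r z i).1)‖)) +
          ENNReal.ofReal (C * ∫ r in s..(s + w), ∑ i : Fin (N + 1),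
            Set.indicator {v : V3 | M < ‖v‖} (fun v => ‖v‖ ^ 3) (((Φ N).flow r z i).2))) ∂P := by
        refine lintegral_mono_ae ?_
        filter_upwards [ae_mem_good_localGibbsLaw σ a₀ u₀ θ₀ N (Φ N)] with z hz
        exact (ENNReal.ofReal_le_ofReal (hpt z hz)).trans ENNReal.ofReal_add_le
    _ = (∫⁻ z, ENNReal.ofReal (η⁻¹ * (((N : ℝ) + 1)⁻¹ * ∑ i : Fin (N + 1), ‖w⁻¹ • ∫ r in s..(s + w),
          (if ‖((Φ N).flow r z i).2 - u s ((Φ N).flow r z i).1‖ ^ 2 ≤ V ^ 2 then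
            R s ((Φ N).flow r z i).1 (‖((Φ N).flow r z i).2 - u s ((Φ N).flow r z i).1‖ ^ 2) else 0) •
            (((Φ N).flow r z i).2 - u s ((Φ N).flow r z i).1)‖)) ∂P) +
          ∫⁻ z, ENNReal.ofReal (C * ∫ r in s..(s + w), ∑ i : Fin (N + 1),
            Set.indicator {v : V3 | M < ‖v‖} (fun v => ‖v‖ ^ 3) (((Φ N).flow r z i).2)) ∂P :=
        lintegral_add_right' _ hg
    _ ≤ ENNReal.ofReal (η⁻¹ * (η * ε / 2)) + ENNReal.ofReal (C * (w * ((N : ℝ) + 1) * e)) := by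
        refine add_le_add ?_ ?_
        · simp_rw [ENNReal.ofReal_mul (inv_nonneg.2 hη.le)]
          rw [lintegral_const_mul' _ _ ENNReal.ofReal_ne_top]
          exact mul_le_mul_right HLs _
        · simp_rw [ENNReal.ofReal_mul hC0]
          rw [lintegral_const_mul' _ _ ENNReal.ofReal_ne_top]
          exact mul_le_mul_right htailW _
    _ = ENNReal.ofReal (ε / 2 + ε / 4) := by
        rw [← ENNReal.ofReal_add (by positivity) (by positivity)]
        congr 1
        rw [hCdef, hedef]
        field_simp
        ring
    _ ≤ ENNReal.ofReal ε := ENNReal.ofReal_le_ofReal (by linarith)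

/-- **Stub S5g of skeleton v8 (line `Sketch`, crux stmt-AtomisticToContinuum-16625), by name and signature.** [folklore] -/
theorem stub_coherenceOfOddWindowLLN : CoherenceOfOddWindowLLN :=
  fun hL hT => coherence_of_boundedOddWindowLLN hL hT

end Summit.AtomisticToContinuum.HydrodynamicLimit.Theorems.TransferEntropyClockOddWindowLLN

end
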